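import Literature.NumberTheory.Sieve.FriedlanderIwaniecPrimesDispersionAssembly
import Literature.NumberTheory.Sieve.FriedlanderIwaniecPrimesCharacterDetection
import Literature.NumberTheory.Sieve.FriedlanderIwaniecSpinCharSums
import Mathlib.NumberTheory.LegendreSymbol.JacobiSymbol
import Mathlib.MeasureTheory.Integral.Bochner.Set
import HarnessLib

/-!
# Friedlander–Iwaniec, *The polynomial `X² + Y⁴` captures its primes*, §10 and §18: the main term `T(β)`, its split `T = U + V + W` ((10.13)–(10.17)), and Theorem 1 from the four block bounds

Family `parity`, statement parity.S17 (`setOf_prime_sq_add_pow_four_infinite`); Line A of the FI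
`a² + b⁴` completion (cell `parity-ideate`, ROUND-8 §8 node (ii) "type the §10 objects"). Source:
J. Friedlander, H. Iwaniec, Ann. of Math. (2) 148 (1998), 945–1040 = arXiv:math/9811185
[FriedlanderIwaniecAnnals1998], (6.1), (7.7), (8.15)–(8.16), (9.10)–(9.12), (10.2), (10.4)–(10.17),
Propositions 10.2, 15.1, 16.3, 17.3, and §18 (arXiv pp. 27, 29, 31–35, 58, 65, 68–69). The typing
of this file is the planner's (seat `parity-ideate-p2`, evidence file `FISection10Blocks.lean`,
2026-08-25, farm-checked); it is landed here unchanged in mathematical content, over the tree's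
`fiBeta₀` (`…SpinCharSums`, (17.15)) instead of a local copy.

The tree has reduced parity.S17 to the single displayed bound (5.25) = `CoprimeDispersionBoundWith`
(`…DispersionCoprime`; consumed by `setOf_prime_sq_add_pow_four_infinite_of_coprimeDispersionBound`,
`…DispersionAssembly`). This file types the objects of §10 over the tree's own objects (`fiZSet`,
`fiZWeight`/`fiBeta`/`fiBeta₀`, `fiDispersionCoprime`, `ratioClass`, `FISectorRegime`, `FICutoff`,
`FISectorCutoff`, `fiRad`):

* "(10.13) `T(β) = 2 Σ_d φ(d)/d ΣΣ_{(z₁,z₂)=1, Δ(z₁,z₂) ≡ 0 (4d)} β_{z₁} β̄_{z₂} ((z₂/z₁)/d) log 2|z₁z₂/Δ|`.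
  Note that `1 ≤ d ≤ N` because `1 ≤ |Δ| ≤ N`. We split this sum into (10.14)
  `T(β) = U(β) + V(β) + W(β)` where (10.15) [`U`: `d ≤ X`, cut `f(|Δ|/d)`], (10.16) [`V`: `d > X`,
  cut `f(|Δ|/d)`], (10.17) [`W`: all `d`, cut `f*(|Δ|/d)`] where `X` will be chosen as a sufficiently
  large power of `log N` and `f`, `f*` are smooth functions whose graphs are [figure: `f* = 1 − f`,
  `f = 0` up to `X`, `f = 1` from `4X` on]" (arXiv pp. 34–35) — `fiTKernel`, `fiTwisted`, `fiT`,
  `fiTenF`/`fiTenFstar`, `fiCutU/V/W`, `fiU/V/W`, and **(10.14) PROVED** (`fiT_eq_fiU_add_fiV_add_fiW`);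
* the coefficients WITHOUT the divisor cut (5.9) ("We no longer need, nor wish to have, this last
  condition `τ(|z|²) ≤ τ`. We remove this in the same way as we have installed it", p. 32):
  `fiZWeight₀` over the tree's `fiBeta₀`, `fiBeta_eq_fiBeta₀`; `f̂(0)` of (7.7) (`fiRadMean`,
  `fiRadMean_le : f̂(0) ≤ 2 M^{1/2}`);
* the common quantifier prefix of (5.25) and of every block bound (`FIRegimeAll`,
  `coprimeDispersionBoundWith_iff : CoprimeDispersionBoundWith … ↔ FIRegimeAll …` by `Iff.rfl`);
* the four BLOCK BOUNDS of §§6–17 as PARAMETRISED statements in the exact quantifier shape of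
  `CoprimeDispersionBoundWith` (statements only — they are the targets of ROUND-8 §8 nodes (i),
  (iii)–(vi); nothing in this file assumes them except as explicit hypotheses):
  `MainTerm1010With` = (9.10) + (10.10)
  (`|𝒟*(M,N) − 2 f̂(0) N'^{-1/2} T(β)| ≤ K {ϑ⁻¹ τ² N² (log N)^b + (τ⁻¹ + θ) θ⁴ M^{1/2} N^{3/2} (log N)^{2^20}}`),
  `Prop151With` = Proposition 15.1 (`V(β) ≪ (P⁻¹ + X^{-1/3}) N²`, `1 ≤ X ≤ N^{1/9}`),
  `Prop163With` = Proposition 16.3 (`U(β) ≪_ν (P⁻¹ + X⁻¹) N² log N`, `1 ≤ X ≤ (log N)^ν`),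
  `Prop173With` = Proposition 17.3 (`W(β) ≪ (P⁻¹ + X⁻¹) N² log N`, `1 ≤ X < N^ε`),
  `Prop102With` = Proposition 10.2 (`T(β) ≪ N² (log N)^{-σ} + P⁻¹ N² log N`);
* §18, BOTH paragraphs, PROVED: `prop102_of_blocks` ("First, assuming Proposition 17.2, we prove
  Proposition 10.2. Recall by (10.14) the decomposition `T(β) = U(β) + V(β) + W(β)` … These three
  parts were estimated … uniformly in `X ≤ (log N)^ν` … Choosing `X = (log N)^{3σ+3}` we complete the
  proof of Proposition 10.2", p. 69) and `coprimeDispersionBound_of_mainTerm` ((5.25) from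
  (9.10)/(10.10) and Proposition 10.2 with the choices (9.12), (10.11)–(10.12): `A' = 2A + 2^20`,
  `τ = (log x)^{2A+2^20}`), composed through the tree into
  **`setOf_prime_sq_add_pow_four_infinite_of_blocks`**: Theorem 1 (parity.S17) from the four block
  bounds, each an explicit hypothesis. So the remaining distance from the tree to FI Theorem 1 is
  EXACTLY the four block bounds (kernel-checked reduction; standard axioms).

Reading notes (planner). (i) `T(β)` of (10.5)/(10.13) carries the coefficients (5.13) WITHOUT the
cut (5.9); the removal cost is the `τ⁻¹` in (10.4)/(10.10). (ii) `N^{-1/2}` in (10.4) is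
`|z₁z₂|^{-1/2}(1+O(θ))`, i.e. the box parameter `N'` of the tree's `fiZSet z₀ N' θ`. (iii) The
smooth partition `f + f* = 1` of (10.15)–(10.17) is given in print only by a figure (arXiv p. 35) and
the sentence "`V(β)` ranges over `d` with `X < d < |Δ|X⁻¹` … while `W(β)` ranges over `d` with
`d* = |Δ|/4d < X`" (p. 57/66): so `f*(u) = 1` for `u ≤ X`, `f*(u) = 0` for `u ≥ 4X`; we fix the
explicit pair `fiTenF`, `fiTenFstar = 1 − fiTenF` built from `Real.smoothTransition` (as the tree
did for `fiRad`). (iv) `((z₂/z₁)/d)` is the Jacobi symbol at the odd part `d'` of `d` ((8.15)) of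
the rational class of `z₂/z₁ (mod 4d)` (`ratioClass (4d) z₂ z₁`, `…CharacterDetection`; cf. `jtChar`
of `…JacobiTwistedForms`). (v) The exact formula (8.16) `G₀(z₁,z₂) = 2 Σ_{4d∣Δ} φ(d)/d ((z₂/z₁)/d)`
(Lemma 8.4) that turns (10.5) into (10.13) is part of the lattice-point block `MainTerm1010With`
(the tree has the crude (8.6) `gCount_le`; the exact count is a separate file).

## References

* J. Friedlander, H. Iwaniec, Ann. of Math. (2) 148 (1998), 945–1040, §§7, 8, 9, 10, 15, 16, 17, 18.
  [FriedlanderIwaniecAnnals1998]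

## Mathlib / tree search

Tree: `fiZSet`, `fiZWeight`, `fiBeta`, `fiDispersionCoprime`, `CoprimeDispersionBoundWith`,
`setOf_prime_sq_add_pow_four_infinite_of_coprimeDispersionBound`, `eventually_log_rpow_le_rpow`,
`eventually_log_rpow_le_P`, `eventually_one_le_M`, `fiRad_nonneg`, `fiRad_le_one`,
`fiRad_eq_zero_of_ge`, `fiBeta₀`, `ratioClass`, `GaussCoprime`, `gaussArg`. Mathlib:
`Real.smoothTransition` (+ `zero_of_nonpos`, `one_of_one_le`, `contDiff`), `jacobiSym`,
`norm_setIntegral_le_of_norm_le_const`, `Real.rpow_*`.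
-/

noncomputable section

open Filter Finset Real MeasureTheory
open scoped ArithmeticFunction.Moebius NumberTheorySymbols
open Literature.NumberTheory.QuadraticFields.GaussianPrimary

namespace Literature.NumberTheory.Sieve.FriedlanderIwaniecPrimes

/-! ### The objects of (6.1), (8.15)–(8.16), (10.2), (10.13) -/

/-- `Δ(z₁, z₂) = Im(z̄₁ z₂) = r₁ s₂ − r₂ s₁`. [cite: FriedlanderIwaniecAnnals1998, (6.1)] -/
def fiDelta (z₁ z₂ : GaussianInt) : ℤ := (star z₁ * z₂).im

/-- `χ_d(z₂/z₁) = ((z₂/z₁)/d)`: the Jacobi symbol, at the odd part `d'` of `d`, of the rational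
residue class of `z₂/z₁` modulo `4d`. [cite: FriedlanderIwaniecAnnals1998, (8.15), (10.2)] -/
def fiChi (d : ℕ) (z₁ z₂ : GaussianInt) : ℤ := J(ratioClass (4 * d) z₂ z₁ | d / 2 ^ d.factorization 2)

/-- `|z₁ z₂| = (|z₁|² |z₂|²)^{1/2}`. [folklore] -/
def fiAbsProd (z₁ z₂ : GaussianInt) : ℝ := Real.sqrt ((z₁.norm : ℝ) * (z₂.norm : ℝ))

/-- The moduli of (8.16)/(10.13): `d ≥ 1` with `4d ∣ Δ(z₁, z₂)` (empty when `Δ = 0`).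
[cite: FriedlanderIwaniecAnnals1998, (8.16), (10.13)] -/
def fiModuli (z₁ z₂ : GaussianInt) : Finset ℕ :=
  ((fiDelta z₁ z₂).natAbs.divisors).filter (fun d => (4 * (d : ℤ)) ∣ fiDelta z₁ z₂)

/-- The arithmetic kernel of (10.13) at the modulus `d`: `φ(d)/d · χ_d(z₂/z₁) · log(2|z₁z₂|/|Δ|)`.
[cite: FriedlanderIwaniecAnnals1998, (10.13)] -/
def fiTKernel (d : ℕ) (z₁ z₂ : GaussianInt) : ℝ :=
  ((d.totient : ℝ) / d) * (fiChi d z₁ z₂ : ℝ) * Real.log (2 * fiAbsProd z₁ z₂ / |(fiDelta z₁ z₂ : ℝ)|)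

/-- The Jacobi-twisted pair form of (10.13)/(10.15)–(10.17) with a cut `g d (|Δ|/d)` inserted:
`2 ∑∑_{(z₁,z₂)=1} b(z₁) b(z₂) ∑_{4d ∣ Δ} g(d, |Δ|/d) φ(d)/d χ_d(z₂/z₁) log(2|z₁z₂|/|Δ|)`.
[cite: FriedlanderIwaniecAnnals1998, (10.13)-(10.17)] -/
def fiTwisted (g : ℕ → ℝ → ℝ) (S : Finset GaussianInt) (b : GaussianInt → ℝ) : ℝ :=
  2 * ∑ z₁ ∈ S, ∑ z₂ ∈ S,
    if GaussCoprime z₁ z₂ then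
      b z₁ * b z₂ * ∑ d ∈ fiModuli z₁ z₂, g d (|(fiDelta z₁ z₂ : ℝ)| / d) * fiTKernel d z₁ z₂
    else 0

/-- `T(β)` of (10.13). [cite: FriedlanderIwaniecAnnals1998, (10.5), (10.13)] -/
def fiT (S : Finset GaussianInt) (b : GaussianInt → ℝ) : ℝ := fiTwisted (fun _ _ => 1) S b

/-- The cut `f` of (10.15)–(10.16): smooth, `= 0` on `u ≤ X`, `= 1` on `u ≥ 4X`.
[cite: FriedlanderIwaniecAnnals1998, after (10.17) (figure, arXiv p. 35)] -/
def fiTenF (X u : ℝ) : ℝ := Real.smoothTransition ((u - X) / (3 * X))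

/-- The complementary cut `f* = 1 − f` of (10.17). [cite: FriedlanderIwaniecAnnals1998, (10.17)] -/
def fiTenFstar (X u : ℝ) : ℝ := 1 - fiTenF X u

/-- The cut of `U(β)`: `d ≤ X` and `f(|Δ|/d)`. [cite: FriedlanderIwaniecAnnals1998, (10.15)] -/
def fiCutU (X : ℝ) (d : ℕ) (u : ℝ) : ℝ := if (d : ℝ) ≤ X then fiTenF X u else 0

/-- The cut of `V(β)`: `d > X` and `f(|Δ|/d)`. [cite: FriedlanderIwaniecAnnals1998, (10.16)] -/
def fiCutV (X : ℝ) (d : ℕ) (u : ℝ) : ℝ := if X < (d : ℝ) then fiTenF X u else 0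

/-- The cut of `W(β)`: `f*(|Δ|/d)`. [cite: FriedlanderIwaniecAnnals1998, (10.17)] -/
def fiCutW (X : ℝ) (_d : ℕ) (u : ℝ) : ℝ := fiTenFstar X u

/-- `U(β)`. [cite: FriedlanderIwaniecAnnals1998, (10.15)] -/
def fiU (X : ℝ) (S : Finset GaussianInt) (b : GaussianInt → ℝ) : ℝ := fiTwisted (fiCutU X) S b

/-- `V(β)`. [cite: FriedlanderIwaniecAnnals1998, (10.16)] -/
def fiV (X : ℝ) (S : Finset GaussianInt) (b : GaussianInt → ℝ) : ℝ := fiTwisted (fiCutV X) S b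

/-- `W(β)`. [cite: FriedlanderIwaniecAnnals1998, (10.17)] -/
def fiW (X : ℝ) (S : Finset GaussianInt) (b : GaussianInt → ℝ) : ℝ := fiTwisted (fiCutW X) S b

/-- `f = 0` for `u ≤ X` (when `X > 0`) — the left flat piece of the figure after (10.17).
[cite: FriedlanderIwaniecAnnals1998, after (10.17) (figure, arXiv p. 35)] -/
theorem fiTenF_eq_zero {X u : ℝ} (hX : 0 < X) (hu : u ≤ X) : fiTenF X u = 0 := by
  unfold fiTenF
  exact Real.smoothTransition.zero_of_nonpos (div_nonpos_of_nonpos_of_nonneg (by linarith) (by positivity))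

/-- `f = 1` for `u ≥ 4X` (when `X > 0`) — the right flat piece of the figure after (10.17).
[cite: FriedlanderIwaniecAnnals1998, after (10.17) (figure, arXiv p. 35)] -/
theorem fiTenF_eq_one {X u : ℝ} (hX : 0 < X) (hu : 4 * X ≤ u) : fiTenF X u = 1 := by
  unfold fiTenF
  refine Real.smoothTransition.one_of_one_le ?_
  rw [le_div_iff₀ (by positivity)]; linarith

/-- `0 ≤ f ≤ 1` (figure after (10.17)). [cite: FriedlanderIwaniecAnnals1998, after (10.17) (figure, arXiv p. 35)] -/
theorem fiTenF_mem_Icc (X u : ℝ) : fiTenF X u ∈ Set.Icc (0 : ℝ) 1 :=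
  ⟨Real.smoothTransition.nonneg _, Real.smoothTransition.le_one _⟩

/-- `f` is smooth ("`f`, `f*` are smooth functions"). [cite: FriedlanderIwaniecAnnals1998, after (10.17)] -/
theorem contDiff_fiTenF (X : ℝ) {n : ℕ∞} : ContDiff ℝ n (fiTenF X) := by
  unfold fiTenF
  exact Real.smoothTransition.contDiff.comp ((contDiff_id.sub contDiff_const).div_const _)

/-- Linearity of the twisted form (10.13) in the cut (the mechanism of the split (10.14)).
[cite: FriedlanderIwaniecAnnals1998, (10.13)-(10.14)] -/
theorem fiTwisted_add (g₁ g₂ : ℕ → ℝ → ℝ) (S : Finset GaussianInt) (b : GaussianInt → ℝ) :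
    fiTwisted (g₁ + g₂) S b = fiTwisted g₁ S b + fiTwisted g₂ S b := by
  unfold fiTwisted
  rw [← mul_add, ← sum_add_distrib]
  congr 1
  refine sum_congr rfl fun z₁ _ => ?_
  rw [← sum_add_distrib]
  refine sum_congr rfl fun z₂ _ => ?_
  split_ifs with h
  · rw [← mul_add, ← sum_add_distrib]
    congr 1
    refine sum_congr rfl fun d _ => ?_
    simp only [Pi.add_apply]
    ring
  · simp

/-- The three cuts form a partition of unity: `[d ≤ X] f + [d > X] f + f* = 1` ((10.14)–(10.17)).
[cite: FriedlanderIwaniecAnnals1998, (10.14)-(10.17)] -/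
theorem fiCutU_add_fiCutV_add_fiCutW (X : ℝ) : fiCutU X + fiCutV X + fiCutW X = fun _ _ => 1 := by
  funext d u
  simp only [Pi.add_apply, fiCutU, fiCutV, fiCutW, fiTenFstar]
  by_cases h₁ : (d : ℝ) ≤ X
  · rw [if_pos h₁, if_neg (not_lt.mpr h₁)]; ring
  · rw [if_neg h₁, if_pos (not_le.mp h₁)]; ring

/-- **(10.14): `T(β) = U(β) + V(β) + W(β)`** for every `X`. [cite: FriedlanderIwaniecAnnals1998, (10.14)] -/
theorem fiT_eq_fiU_add_fiV_add_fiW (X : ℝ) (S : Finset GaussianInt) (b : GaussianInt → ℝ) :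
    fiT S b = fiU X S b + fiV X S b + fiW X S b := by
  unfold fiT fiU fiV fiW
  rw [← fiCutU_add_fiCutV_add_fiCutW X, fiTwisted_add, fiTwisted_add]

/-! ### The coefficients without the cut (5.9), and `f̂(0)` of (7.7) -/

/-- `β(n) = β₀(n)` wherever the divisor cut (5.9) `τ(n) ≤ τ` is void.
[cite: FriedlanderIwaniecAnnals1998, (5.9), (5.13), §10 before (10.4)] -/
theorem fiBeta_eq_fiBeta₀ (p : ℝ → ℝ) (C P : ℝ) {τ : ℝ} {n : ℕ}
    (h : ((ArithmeticFunction.sigma 0 n : ℕ) : ℝ) ≤ τ) :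
    fiBeta p C P τ n = fiBeta₀ p C P n := by
  by_cases hP : (∀ q ∈ n.primeFactors, P ≤ (q : ℝ))
  · rw [fiBeta, fiBeta₀, if_pos ⟨hP, h⟩, if_pos hP]
  · rw [fiBeta, fiBeta₀, if_neg (fun h' => hP h'.1), if_neg hP]

/-- `β_z` of (5.13) without (5.9): `β₀(|z|²) q(arg z)`. [cite: FriedlanderIwaniecAnnals1998, (5.13)] -/
def fiZWeight₀ (q p : ℝ → ℝ) (C P : ℝ) (z : GaussianInt) : ℝ :=
  fiBeta₀ p C P z.norm.natAbs * q (gaussArg z)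

/-- `f̂(0) = ∫₀^∞ f(u) du` for the radial majorant `f(w) = 𝔣(|w|²)`, `𝔣 = fiRad M` ((7.7); `≪ M^{1/2}`).
[cite: FriedlanderIwaniecAnnals1998, (7.7)] -/
def fiRadMean (M : ℝ) : ℝ := ∫ u in Set.Ioi (0 : ℝ), fiRad M (u ^ 2)

/-! ### The regime quantifier of §§5–18 and the four block bounds (parametrised statements) -/

/-- "For all large `x` and all data of the regime": the common quantifier prefix of
`Bilinear515With`, `DispersionBoundWith`, `CoprimeDispersionBoundWith` (`ϑ = (log x)^{-A}`,
`θ = (log x)^{-A'}`). [cite: FriedlanderIwaniecAnnals1998, (4.4), (4.6), (4.12)-(4.14), (4.19), (5.12)-(5.14)] -/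
def FIRegimeAll (η A A₁ A' B : ℝ)
    (Φ : ℝ → ℝ → ℝ → ℝ → ℝ → ℝ → (ℝ → ℝ) → GaussianInt → (ℝ → ℝ) → Prop) : Prop :=
  ∀ᶠ x : ℝ in atTop, ∀ P N M C N' : ℝ, FISectorRegime η A₁ B x P N M C N' →
    ∀ p : ℝ → ℝ, FICutoff (Real.log x ^ (-A')) N N' p →
    ∀ z₀ : GaussianInt, ∀ φ : ℝ, ∀ q : ℝ → ℝ,
      FISectorCutoff (Real.log x ^ (-A)) (Real.log x ^ (-A')) φ q → Φ x P N M C N' p z₀ q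

/-- (5.25) is a `FIRegimeAll` statement (definitionally). [cite: FriedlanderIwaniecAnnals1998, (5.25)] -/
theorem coprimeDispersionBoundWith_iff (η A A₁ A' t B K : ℝ) :
    CoprimeDispersionBoundWith η A A₁ A' t B K ↔ FIRegimeAll η A A₁ A' B fun x P N M C N' p z₀ q =>
      fiDispersionCoprime q p z₀ M N' (Real.log x ^ (-A')) C P (Real.log x ^ t) ≤
        K * (Real.log x ^ (-A)) ^ 2 * (Real.log x ^ (-A')) ^ 4 *
          (M ^ (1 / 2 : ℝ) * N ^ (3 / 2 : ℝ)) * Real.log (M * N) ^ 8 :=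
  Iff.rfl

/-- Conjunction of two statements over the regime of (5.25). [cite: FriedlanderIwaniecAnnals1998, (5.25), §18] -/
theorem FIRegimeAll.and {η A A₁ A' B : ℝ} {Φ₁ Φ₂ : ℝ → ℝ → ℝ → ℝ → ℝ → ℝ → (ℝ → ℝ) → GaussianInt → (ℝ → ℝ) → Prop}
    (h₁ : FIRegimeAll η A A₁ A' B Φ₁) (h₂ : FIRegimeAll η A A₁ A' B Φ₂) :
    FIRegimeAll η A A₁ A' B fun x P N M C N' p z₀ q => Φ₁ x P N M C N' p z₀ q ∧ Φ₂ x P N M C N' p z₀ q := by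
  filter_upwards [h₁, h₂] with x hx₁ hx₂ P N M C N' hr p hp z₀ φ q hq
  exact ⟨hx₁ P N M C N' hr p hp z₀ φ q hq, hx₂ P N M C N' hr p hp z₀ φ q hq⟩

/-- Monotonicity of a statement over the regime of (5.25) along an eventual implication.
[cite: FriedlanderIwaniecAnnals1998, (5.25), §18] -/
theorem FIRegimeAll.mono' {η A A₁ A' B : ℝ} {Φ₁ Φ₂ : ℝ → ℝ → ℝ → ℝ → ℝ → ℝ → (ℝ → ℝ) → GaussianInt → (ℝ → ℝ) → Prop}
    (h₁ : FIRegimeAll η A A₁ A' B Φ₁)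
    (himp : ∀ᶠ x : ℝ in atTop, ∀ P N M C N' : ℝ, FISectorRegime η A₁ B x P N M C N' →
      ∀ (p : ℝ → ℝ) (z₀ : GaussianInt) (q : ℝ → ℝ), Φ₁ x P N M C N' p z₀ q → Φ₂ x P N M C N' p z₀ q) :
    FIRegimeAll η A A₁ A' B Φ₂ := by
  filter_upwards [h₁, himp] with x hx hi P N M C N' hr p hp z₀ φ q hq
  exact hi P N M C N' hr p z₀ q (hx P N M C N' hr p hp z₀ φ q hq)

/-- **Lattice-point block target = (9.10) + (10.10)**, parametrised: throughout the regime,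
`|𝒟*(M,N) − 2 f̂(0) N'^{-1/2} T(β₀)| ≤ K {ϑ⁻¹ τ² N² (log N)^b + (τ⁻¹ + θ) θ⁴ M^{1/2} N^{3/2} (log N)^{2^20}}`
(`𝒟* = fiDispersionCoprime` with the cut coefficients, `T` with the uncut ones; `b = b(η)`).
This is what §§6–9 and Lemma 10.1 prove. [cite: FriedlanderIwaniecAnnals1998, (9.10)-(9.11), (10.4)-(10.10)] -/
def MainTerm1010With (η A A₁ A' t B b K : ℝ) : Prop :=
  FIRegimeAll η A A₁ A' B fun x P N M C N' p z₀ q =>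
    |fiDispersionCoprime q p z₀ M N' (Real.log x ^ (-A')) C P (Real.log x ^ t)
        - 2 * fiRadMean M * N' ^ (-(1 / 2 : ℝ)) *
            fiT (fiZSet z₀ N' (Real.log x ^ (-A'))) (fiZWeight₀ q p C P)|
      ≤ K * ((Real.log x ^ (-A))⁻¹ * (Real.log x ^ t) ^ 2 * N ^ 2 * Real.log N ^ b
          + ((Real.log x ^ t)⁻¹ + Real.log x ^ (-A')) * (Real.log x ^ (-A')) ^ 4 *
              M ^ (1 / 2 : ℝ) * N ^ (3 / 2 : ℝ) * Real.log N ^ (2 ^ 20 : ℝ))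

/-- **Proposition 10.2**, parametrised: throughout the regime,
`|T(β₀)| ≤ K (N² (log N)^{-σ} + P⁻¹ N² log N)`. [cite: FriedlanderIwaniecAnnals1998, Proposition 10.2] -/
def Prop102With (η A A₁ A' B σ K : ℝ) : Prop :=
  FIRegimeAll η A A₁ A' B fun x P N _M C N' p z₀ q =>
    |fiT (fiZSet z₀ N' (Real.log x ^ (-A'))) (fiZWeight₀ q p C P)|
      ≤ K * (N ^ 2 * Real.log N ^ (-σ) + P⁻¹ * N ^ 2 * Real.log N)

/-- **Proposition 15.1 (medium moduli)**, parametrised: throughout the regime, for `1 ≤ X ≤ N^{1/9}`,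
`|V(β₀)| ≤ K (P⁻¹ + X^{-1/3}) N²`. [cite: FriedlanderIwaniecAnnals1998, Proposition 15.1, (15.8)] -/
def Prop151With (η A A₁ A' B K : ℝ) : Prop :=
  FIRegimeAll η A A₁ A' B fun x P N _M C N' p z₀ q => ∀ X : ℝ, 1 ≤ X → X ≤ N ^ (1 / 9 : ℝ) →
    |fiV X (fiZSet z₀ N' (Real.log x ^ (-A'))) (fiZWeight₀ q p C P)|
      ≤ K * (P⁻¹ + X ^ (-(1 / 3 : ℝ))) * N ^ 2

/-- **Proposition 16.3 (small moduli)**, parametrised: throughout the regime, for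
`1 ≤ X ≤ (log N)^ν`, `|U(β₀)| ≤ K (P⁻¹ + X⁻¹) N² log N`. [cite: FriedlanderIwaniecAnnals1998, Proposition 16.3, (16.41)] -/
def Prop163With (η A A₁ A' B ν K : ℝ) : Prop :=
  FIRegimeAll η A A₁ A' B fun x P N _M C N' p z₀ q => ∀ X : ℝ, 1 ≤ X → X ≤ Real.log N ^ ν →
    |fiU X (fiZSet z₀ N' (Real.log x ^ (-A'))) (fiZWeight₀ q p C P)|
      ≤ K * (P⁻¹ + X⁻¹) * N ^ 2 * Real.log N

/-- **Proposition 17.3 (large moduli)**, parametrised: throughout the regime, for `1 ≤ X < N^ε`,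
`|W(β₀)| ≤ K (P⁻¹ + X⁻¹) N² log N`. [cite: FriedlanderIwaniecAnnals1998, Proposition 17.3, (17.19)] -/
def Prop173With (η A A₁ A' B ε K : ℝ) : Prop :=
  FIRegimeAll η A A₁ A' B fun x P N _M C N' p z₀ q => ∀ X : ℝ, 1 ≤ X → X < N ^ ε →
    |fiW X (fiZSet z₀ N' (Real.log x ^ (-A'))) (fiZWeight₀ q p C P)|
      ≤ K * (P⁻¹ + X⁻¹) * N ^ 2 * Real.log N

/-! ### §18, first paragraph: Proposition 10.2 from Propositions 15.1, 16.3, 17.3 (PROVED) -/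

/-- **§18: `T(β) ≪ (P⁻¹ + X^{-1/3}) N² log N` uniformly in `X ≤ (log N)^ν`; with `X = (log N)^{3σ+3}`
this is Proposition 10.2.** [cite: FriedlanderIwaniecAnnals1998, §18 (first paragraph)] -/
theorem prop102_of_blocks
    (hV : ∀ η A A₁ A' B : ℝ, 0 < η → 0 < A → 0 < A₁ → 2 ^ 20 ≤ A' → 0 < B →
      ∃ K : ℝ, 0 < K ∧ Prop151With η A A₁ A' B K)
    (hU : ∀ η A A₁ A' B : ℝ, 0 < η → 0 < A → 0 < A₁ → 2 ^ 20 ≤ A' → 0 < B →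
      ∀ ν : ℝ, 0 < ν → ∃ K : ℝ, 0 < K ∧ Prop163With η A A₁ A' B ν K)
    (hW : ∀ η A A₁ A' B : ℝ, 0 < η → 0 < A → 0 < A₁ → 2 ^ 20 ≤ A' → 0 < B →
      ∃ ε : ℝ, 0 < ε ∧ ∃ K : ℝ, 0 < K ∧ Prop173With η A A₁ A' B ε K) :
    ∀ η A A₁ A' B : ℝ, 0 < η → 0 < A → 0 < A₁ → 2 ^ 20 ≤ A' → 0 < B →
      ∀ σ : ℝ, 0 < σ → ∃ K : ℝ, 0 < K ∧ Prop102With η A A₁ A' B σ K := by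
  intro η A A₁ A' B hη hA hA₁ hA' hB σ hσ
  obtain ⟨K₁, hK₁, h₁⟩ := hV η A A₁ A' B hη hA hA₁ hA' hB
  obtain ⟨K₂, hK₂, h₂⟩ := hU η A A₁ A' B hη hA hA₁ hA' hB (3 * σ + 3) (by linarith)
  obtain ⟨ε, hε, K₃, hK₃, h₃⟩ := hW η A A₁ A' B hη hA hA₁ hA' hB
  refine ⟨K₁ + K₂ + K₃, by positivity, ?_⟩
  -- growth facts in the variable `N`
  have hgrow : ∀ᶠ N : ℝ in atTop, 1 ≤ Real.log N ∧ Real.log N ^ (3 * σ + 3) ≤ N ^ (1 / 9 : ℝ) ∧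
      Real.log N ^ (3 * σ + 3) < N ^ ε := by
    have h9 := eventually_log_rpow_le_rpow (3 * σ + 3) (by norm_num : (0 : ℝ) < 1 / 9) one_pos
    have hε' := eventually_log_rpow_le_rpow (3 * σ + 3) (half_pos hε) one_pos
    have hl : ∀ᶠ N : ℝ in atTop, 1 ≤ Real.log N := Real.tendsto_log_atTop.eventually_ge_atTop 1
    filter_upwards [h9, hε', hl, eventually_gt_atTop 1] with N h9 hε' hl hN1
    have hlt : N ^ (ε / 2) < N ^ ε := Real.rpow_lt_rpow_of_exponent_lt hN1 (by linarith)
    exact ⟨hl, by linarith, by linarith⟩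
  obtain ⟨N₀, hN₀⟩ := Filter.eventually_atTop.mp hgrow
  have hxN : ∀ᶠ x : ℝ in atTop, N₀ ≤ x ^ (1 / 4 + η : ℝ) :=
    (tendsto_rpow_atTop (by linarith : (0 : ℝ) < 1 / 4 + η)).eventually_ge_atTop N₀
  refine (FIRegimeAll.and (FIRegimeAll.and h₁ h₂) h₃).mono' ?_
  filter_upwards [hxN] with x hx P N M C N' hr p z₀ q hΦ
  obtain ⟨⟨hV', hU'⟩, hW'⟩ := hΦ
  have hNN₀ : N₀ ≤ N := hx.trans hr.N_gt.le
  obtain ⟨hl1, h9, hε9⟩ := hN₀ N hNN₀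
  have hL0 : 0 < Real.log N := by linarith
  set L := Real.log N with hL
  set X : ℝ := L ^ (3 * σ + 3) with hX
  have hX1 : 1 ≤ X := Real.one_le_rpow hl1 (by linarith)
  have hX0 : 0 < X := by linarith
  have hV'' := hV' X hX1 h9
  have hU'' := hU' X hX1 le_rfl
  have hW'' := hW' X hX1 hε9
  have hP0 : 0 < P := hr.P_pos
  have hPi : 0 ≤ P⁻¹ := inv_nonneg.mpr hP0.le
  have hN2 : 0 ≤ N ^ 2 := sq_nonneg N
  -- `X^{-1/3} = L^{-(σ+1)}`, `X⁻¹ ≤ X^{-1/3}`, `L^{-(σ+1)} L = L^{-σ}`, `L^{-(σ+1)} ≤ L^{-σ}`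
  have hX13 : X ^ (-(1 / 3 : ℝ)) = L ^ (-(σ + 1)) := by
    rw [hX, ← Real.rpow_mul hL0.le]; congr 1; ring
  have hXinv : X⁻¹ ≤ X ^ (-(1 / 3 : ℝ)) := by
    rw [← Real.rpow_neg_one]
    exact Real.rpow_le_rpow_of_exponent_le hX1 (by norm_num)
  have hLσ : L ^ (-(σ + 1)) * L = L ^ (-σ) := by
    rw [← Real.rpow_add_one hL0.ne']; congr 1; ring
  have hLσ' : L ^ (-(σ + 1)) ≤ L ^ (-σ) := Real.rpow_le_rpow_of_exponent_le hl1 (by linarith)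
  have hLσ0 : 0 ≤ L ^ (-σ) := Real.rpow_nonneg hL0.le _
  have e1 : X⁻¹ * N ^ 2 * L ≤ N ^ 2 * L ^ (-σ) := by
    calc X⁻¹ * N ^ 2 * L ≤ X ^ (-(1 / 3 : ℝ)) * N ^ 2 * L :=
          mul_le_mul_of_nonneg_right (mul_le_mul_of_nonneg_right hXinv hN2) hL0.le
      _ = N ^ 2 * (L ^ (-(σ + 1)) * L) := by rw [hX13]; ring
      _ = N ^ 2 * L ^ (-σ) := by rw [hLσ]
  have e2 : X ^ (-(1 / 3 : ℝ)) * N ^ 2 ≤ N ^ 2 * L ^ (-σ) := by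
    rw [hX13, mul_comm]
    exact mul_le_mul_of_nonneg_left hLσ' hN2
  have e3 : P⁻¹ * N ^ 2 ≤ P⁻¹ * N ^ 2 * L := le_mul_of_one_le_right (mul_nonneg hPi hN2) hl1
  rw [fiT_eq_fiU_add_fiV_add_fiW X]
  have expand : K₂ * (P⁻¹ + X⁻¹) * N ^ 2 * L + K₁ * (P⁻¹ + X ^ (-(1 / 3 : ℝ))) * N ^ 2 +
        K₃ * (P⁻¹ + X⁻¹) * N ^ 2 * L
      = K₂ * (P⁻¹ * N ^ 2 * L) + K₂ * (X⁻¹ * N ^ 2 * L) + K₁ * (P⁻¹ * N ^ 2) +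
        K₁ * (X ^ (-(1 / 3 : ℝ)) * N ^ 2) + K₃ * (P⁻¹ * N ^ 2 * L) + K₃ * (X⁻¹ * N ^ 2 * L) := by
    ring
  calc |fiU X _ _ + fiV X _ _ + fiW X _ _|
      ≤ |fiU X (fiZSet z₀ N' (Real.log x ^ (-A'))) (fiZWeight₀ q p C P)|
        + |fiV X (fiZSet z₀ N' (Real.log x ^ (-A'))) (fiZWeight₀ q p C P)|
        + |fiW X (fiZSet z₀ N' (Real.log x ^ (-A'))) (fiZWeight₀ q p C P)| := abs_add_three _ _ _
    _ ≤ K₂ * (P⁻¹ + X⁻¹) * N ^ 2 * L + K₁ * (P⁻¹ + X ^ (-(1 / 3 : ℝ))) * N ^ 2 +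
        K₃ * (P⁻¹ + X⁻¹) * N ^ 2 * L := by linarith
    _ ≤ (K₁ + K₂ + K₃) * (N ^ 2 * L ^ (-σ) + P⁻¹ * N ^ 2 * L) := by
        rw [expand]
        nlinarith [mul_le_mul_of_nonneg_left e1 hK₂.le, mul_le_mul_of_nonneg_left e2 hK₁.le,
          mul_le_mul_of_nonneg_left e3 hK₁.le, mul_le_mul_of_nonneg_left e1 hK₃.le,
          mul_nonneg hK₂.le (mul_nonneg (mul_nonneg hPi hN2) hL0.le)]

/-! ### §18, second paragraph: (5.25) from the lattice-point block and Proposition 10.2 (PROVED) -/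

/-- `0 ≤ f̂(0)` ((7.7), `f ≥ 0`). [cite: FriedlanderIwaniecAnnals1998, (7.7)] -/
theorem fiRadMean_nonneg (M : ℝ) : 0 ≤ fiRadMean M :=
  setIntegral_nonneg measurableSet_Ioi fun _ _ => fiRad_nonneg M _

/-- `f̂(0) ≤ 2 M^{1/2}` ((7.7): `f̂(0) ≪ M^{1/2}`), since `0 ≤ 𝔣 ≤ 1` and `𝔣(u²) = 0` for `u ≥ 2√M`.
[cite: FriedlanderIwaniecAnnals1998, (7.7)] -/
theorem fiRadMean_le {M : ℝ} (hM : 0 < M) : fiRadMean M ≤ 2 * M ^ (1 / 2 : ℝ) := by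
  have hR0 : 0 < 2 * M ^ (1 / 2 : ℝ) := by positivity
  have hR2 : (2 * M ^ (1 / 2 : ℝ)) ^ 2 = 4 * M := by
    rw [mul_pow, ← Real.rpow_natCast (M ^ (1 / 2 : ℝ)) 2, ← Real.rpow_mul hM.le]; norm_num
  unfold fiRadMean
  rw [setIntegral_eq_of_subset_of_forall_sdiff_eq_zero measurableSet_Ioi
    (Set.Ioc_subset_Ioi_self : Set.Ioc 0 (2 * M ^ (1 / 2 : ℝ)) ⊆ Set.Ioi 0) ?_]
  · calc ∫ u in Set.Ioc 0 (2 * M ^ (1 / 2 : ℝ)), fiRad M (u ^ 2)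
          ≤ ‖∫ u in Set.Ioc 0 (2 * M ^ (1 / 2 : ℝ)), fiRad M (u ^ 2)‖ := Real.le_norm_self _
      _ ≤ 1 * volume.real (Set.Ioc 0 (2 * M ^ (1 / 2 : ℝ))) :=
          norm_setIntegral_le_of_norm_le_const measure_Ioc_lt_top fun u _ => by
            rw [Real.norm_of_nonneg (fiRad_nonneg _ _)]; exact fiRad_le_one _ _
      _ = 2 * M ^ (1 / 2 : ℝ) := by rw [Real.volume_real_Ioc_of_le hR0.le, sub_zero, one_mul]
  · rintro u ⟨hu0, hu⟩
    have hu' : 2 * M ^ (1 / 2 : ℝ) < u := by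
      by_contra h
      exact hu ⟨hu0, not_lt.mp h⟩
    apply fiRad_eq_zero_of_ge hM
    nlinarith [hR2, hu', hR0]

set_option maxHeartbeats 1600000 in
/-- **§18: (5.25) from (9.10)/(10.10) and Proposition 10.2**, with the printed choices
`A' = 2A + 2^20`, `τ = (log x)^{2A + 2^20}` ((10.11)–(10.12)), `σ = 2A + 4A'`,
`B = 3A + 4A' + 2t + b + A₁ + 1` ((9.12)), `K = 3K₁ + 4·4^σ K₂ + 4K₂`; uses `f̂(0) ≤ 2M^{1/2}` ((7.7)),
`(log N)^{-σ} ≤ 4^σ (log x)^{-σ}` (`N > x^{1/4}`) and `eventually_log_rpow_le_P` for the `P⁻¹` term.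
[cite: FriedlanderIwaniecAnnals1998, §18, (9.12), (10.11)-(10.12)] -/
theorem coprimeDispersionBound_of_mainTerm
    (hM : ∀ η : ℝ, 0 < η → ∃ b : ℝ, 0 ≤ b ∧ ∀ A A₁ A' t B : ℝ, 0 < A → 0 < A₁ → 0 < A' → 0 < t →
      0 < B → ∃ K : ℝ, 0 < K ∧ MainTerm1010With η A A₁ A' t B b K)
    (hT : ∀ η A A₁ A' B : ℝ, 0 < η → 0 < A → 0 < A₁ → 2 ^ 20 ≤ A' → 0 < B →
      ∀ σ : ℝ, 0 < σ → ∃ K : ℝ, 0 < K ∧ Prop102With η A A₁ A' B σ K) :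
    ∀ η : ℝ, 0 < η → ∀ A : ℝ, 0 < A → ∀ A₁ : ℝ, 0 < A₁ →
      ∃ A' t B K : ℝ, 2 * A + 2 ^ 20 ≤ A' ∧ A + 124 ≤ t ∧ 0 < B ∧ 0 < K ∧
        CoprimeDispersionBoundWith η A A₁ A' t B K := by
  intro η hη A hA A₁ hA₁
  obtain ⟨b, hb, hM'⟩ := hM η hη
  obtain ⟨A', hA'eq⟩ : ∃ A' : ℝ, A' = 2 * A + 2 ^ 20 := ⟨_, rfl⟩
  obtain ⟨t, hteq⟩ : ∃ t : ℝ, t = 2 * A + 2 ^ 20 := ⟨_, rfl⟩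
  obtain ⟨σ, hσeq⟩ : ∃ σ : ℝ, σ = 2 * A + 4 * A' := ⟨_, rfl⟩
  obtain ⟨e, heeq⟩ : ∃ e : ℝ, e = 3 * A + 4 * A' + 2 * t + b := ⟨_, rfl⟩
  obtain ⟨B, hBeq⟩ : ∃ B : ℝ, B = e + A₁ + 1 := ⟨_, rfl⟩
  have h220 : (124 : ℝ) ≤ 2 ^ 20 := by norm_num
  have hA'0 : 0 < A' := by rw [hA'eq]; positivity
  have ht0 : 0 < t := by rw [hteq]; positivity
  have hσ0 : 0 < σ := by rw [hσeq]; positivity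
  have he0 : 0 < e := by rw [heeq]; positivity
  have hB0 : 0 < B := by rw [hBeq]; positivity
  obtain ⟨K₁, hK₁, h₁⟩ := hM' A A₁ A' t B hA hA₁ hA'0 ht0 hB0
  obtain ⟨K₂, hK₂, h₂⟩ := hT η A A₁ A' B hη hA hA₁ (by rw [hA'eq]; linarith) hB0 σ hσ0
  have h4σ : (0 : ℝ) < 4 ^ σ := by positivity
  refine ⟨A', t, B, 3 * K₁ + 4 * 4 ^ σ * K₂ + 4 * K₂, by rw [hA'eq], by rw [hteq]; linarith,
    hB0, by positivity, ?_⟩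
  rw [coprimeDispersionBoundWith_iff]
  refine (FIRegimeAll.and h₁ h₂).mono' ?_
  filter_upwards [eventually_one_le_M η A₁ B, eventually_log_rpow_le_P (σ + 1) one_pos,
    eventually_log_rpow_le_rpow A₁ one_pos (Real.exp_pos 1), eventually_ge_atTop (Real.exp 1)]
    with x hM1 hPx hex hxe P N M C N' hr p z₀ q hΦ
  show fiDispersionCoprime q p z₀ M N' (Real.log x ^ (-A')) C P (Real.log x ^ t) ≤ _
  obtain ⟨hmain, hTb⟩ := hΦ
  obtain ⟨hM1', hMN1, hN0⟩ := hM1 P N M C N' hr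
  -- basic size facts
  have hx1 : 1 < x := lt_of_lt_of_le (by linarith [Real.add_one_le_exp (1 : ℝ)]) hxe
  have hx0 : 0 < x := by linarith
  have hL1 : 1 ≤ Real.log x := by rwa [Real.le_log_iff_exp_le hx0]
  have hL0 : 0 < Real.log x := by linarith
  have hM0 : 0 < M := by linarith
  have hP0 : 0 < P := hr.P_pos
  have hN'0 : 0 < N' := hN0.trans hr.N'_gt
  have hlN_gt : (1 / 4 + η) * Real.log x < Real.log N := by
    rw [← Real.log_rpow hx0]
    exact Real.log_lt_log (Real.rpow_pos_of_pos hx0 _) hr.N_gt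
  have hNx : N ≤ x := by
    have h1 : x ^ (1 / 2 : ℝ) / Real.log x ^ B ≤ x ^ (1 / 2 : ℝ) :=
      div_le_self (Real.rpow_nonneg hx0.le _) (Real.one_le_rpow hL1 hB0.le)
    have h2 : x ^ (1 / 2 : ℝ) ≤ x := by
      conv_rhs => rw [← Real.rpow_one x]
      exact Real.rpow_le_rpow_of_exponent_le hx1.le (by norm_num)
    linarith [hr.N_lt]
  have hlN_le : Real.log N ≤ Real.log x := Real.log_le_log hN0 hNx
  have hlN0 : 0 < Real.log N := by
    have : 0 < (1 / 4 + η) * Real.log x := by positivity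
    linarith
  have hPge : Real.log x ^ (σ + 1) ≤ P := by
    have := hPx P hP0 hr.logP_ge
    rwa [one_mul] at this
  have hlMN : 1 ≤ Real.log (M * N) := by
    have hMN0 : 0 < M * N := by positivity
    rw [Real.le_log_iff_exp_le hMN0]
    have h1 : Real.exp 1 ≤ x / Real.log x ^ A₁ := by
      rw [le_div_iff₀ (Real.rpow_pos_of_pos hL0 _)]
      have := hex
      rwa [Real.rpow_one] at this
    linarith [hr.MN_gt]
  have hl8 : 1 ≤ Real.log (M * N) ^ 8 := one_le_pow₀ hlMN
  set L := Real.log x with hLdef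
  set l := Real.log N with hldef
  -- rpow identities
  have hϑθ : (L ^ (-A)) ^ 2 * (L ^ (-A')) ^ 4 = L ^ (-σ) := by
    rw [← Real.rpow_natCast (L ^ (-A)) 2, ← Real.rpow_natCast (L ^ (-A')) 4,
      ← Real.rpow_mul hL0.le, ← Real.rpow_mul hL0.le, ← Real.rpow_add hL0]
    congr 1; rw [hσeq]; push_cast; ring
  have hMN32 : (M * N) ^ (1 / 2 : ℝ) * N = M ^ (1 / 2 : ℝ) * N ^ (3 / 2 : ℝ) := by
    rw [Real.mul_rpow hM0.le hN0.le, mul_assoc, ← Real.rpow_add_one hN0.ne']; norm_num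
  have hN2 : N ^ (-(1 / 2 : ℝ)) * N ^ 2 = N ^ (3 / 2 : ℝ) := by
    rw [← Real.rpow_natCast N 2, ← Real.rpow_add hN0]; norm_num
  -- (T1) ϑ⁻¹ τ² N² (log N)^b ≤ W := (log x)^{-σ} M^{1/2} N^{3/2}
  have hkey : L ^ (2 * e) * N ^ 2 ≤ M * N := by
    have hx2 : (x ^ (1 / 2 : ℝ)) ^ 2 = x := by
      rw [← Real.rpow_natCast (x ^ (1 / 2 : ℝ)) 2, ← Real.rpow_mul hx0.le]; norm_num
    have hL2 : (L ^ B) ^ 2 = L ^ (2 * B) := by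
      rw [← Real.rpow_natCast (L ^ B) 2, ← Real.rpow_mul hL0.le]; congr 1; push_cast; ring
    have hN2lt : N ^ 2 < x * L ^ (-(2 * B)) := by
      have h1 : N ^ 2 < (x ^ (1 / 2 : ℝ) / L ^ B) ^ 2 := pow_lt_pow_left₀ hr.N_lt hN0.le two_ne_zero
      rw [div_pow, hx2, hL2] at h1
      rwa [Real.rpow_neg hL0.le (2 * B), ← div_eq_mul_inv]
    have hLe : L ^ (2 * e) * L ^ (-(2 * B)) ≤ L ^ (-A₁) := by
      rw [← Real.rpow_add hL0]
      exact Real.rpow_le_rpow_of_exponent_le hL1 (by rw [hBeq]; linarith)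
    calc L ^ (2 * e) * N ^ 2 ≤ L ^ (2 * e) * (x * L ^ (-(2 * B))) :=
          mul_le_mul_of_nonneg_left hN2lt.le (by positivity)
      _ = x * (L ^ (2 * e) * L ^ (-(2 * B))) := by ring
      _ ≤ x * L ^ (-A₁) := mul_le_mul_of_nonneg_left hLe hx0.le
      _ = x / L ^ A₁ := by rw [Real.rpow_neg hL0.le A₁, div_eq_mul_inv]
      _ ≤ M * N := hr.MN_gt.le
  have hsq : L ^ e * N ≤ (M * N) ^ (1 / 2 : ℝ) := by
    have h := Real.rpow_le_rpow (by positivity) hkey (by norm_num : (0 : ℝ) ≤ 1 / 2)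
    rw [Real.mul_rpow (x := L ^ (2 * e)) (y := N ^ 2) (by positivity) (by positivity),
      ← Real.rpow_mul hL0.le, ← Real.rpow_natCast N 2, ← Real.rpow_mul hN0.le,
      show 2 * e * (1 / 2 : ℝ) = e by ring, show ((2 : ℕ) : ℝ) * (1 / 2 : ℝ) = 1 by norm_num,
      Real.rpow_one] at h
    exact h
  have hT1 : (L ^ (-A))⁻¹ * (L ^ t) ^ 2 * N ^ 2 * l ^ b ≤ L ^ (-σ) * (M ^ (1 / 2 : ℝ) * N ^ (3 / 2 : ℝ)) := by
    have hlb : l ^ b ≤ L ^ b := Real.rpow_le_rpow hlN0.le hlN_le hb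
    have hcoef : (L ^ (-A))⁻¹ * (L ^ t) ^ 2 * L ^ b = L ^ (-σ) * L ^ e := by
      rw [Real.rpow_neg hL0.le A, inv_inv, ← Real.rpow_natCast (L ^ t) 2, ← Real.rpow_mul hL0.le,
        ← Real.rpow_add hL0, ← Real.rpow_add hL0, ← Real.rpow_add hL0]
      congr 1; rw [hσeq, heeq]; push_cast; ring
    calc (L ^ (-A))⁻¹ * (L ^ t) ^ 2 * N ^ 2 * l ^ b
        ≤ (L ^ (-A))⁻¹ * (L ^ t) ^ 2 * N ^ 2 * L ^ b := mul_le_mul_of_nonneg_left hlb (by positivity)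
      _ = L ^ (-σ) * ((L ^ e * N) * N) := by
          rw [show (L ^ (-A))⁻¹ * (L ^ t) ^ 2 * N ^ 2 * L ^ b
              = ((L ^ (-A))⁻¹ * (L ^ t) ^ 2 * L ^ b) * N ^ 2 by ring, hcoef]
          ring
      _ ≤ L ^ (-σ) * ((M * N) ^ (1 / 2 : ℝ) * N) :=
          mul_le_mul_of_nonneg_left (mul_le_mul_of_nonneg_right hsq hN0.le) (by positivity)
      _ = L ^ (-σ) * (M ^ (1 / 2 : ℝ) * N ^ (3 / 2 : ℝ)) := by rw [hMN32]
  -- (T2) (τ⁻¹ + θ) θ⁴ M^{1/2} N^{3/2} (log N)^{2^20} ≤ 2 W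
  have hT2 : ((L ^ t)⁻¹ + L ^ (-A')) * (L ^ (-A')) ^ 4 * M ^ (1 / 2 : ℝ) * N ^ (3 / 2 : ℝ) *
        l ^ (2 ^ 20 : ℝ) ≤ 2 * (L ^ (-σ) * (M ^ (1 / 2 : ℝ) * N ^ (3 / 2 : ℝ))) := by
    have hl20 : l ^ (2 ^ 20 : ℝ) ≤ L ^ (2 ^ 20 : ℝ) := Real.rpow_le_rpow hlN0.le hlN_le (by positivity)
    have hcoef : ((L ^ t)⁻¹ + L ^ (-A')) * (L ^ (-A')) ^ 4 * L ^ (2 ^ 20 : ℝ) = 2 * L ^ (-σ) := by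
      have e1 : (L ^ t)⁻¹ * L ^ (2 ^ 20 : ℝ) = L ^ (-(2 * A)) := by
        rw [← Real.rpow_neg hL0.le t, ← Real.rpow_add hL0]; congr 1; rw [hteq]; ring
      have e2 : L ^ (-A') * L ^ (2 ^ 20 : ℝ) = L ^ (-(2 * A)) := by
        rw [← Real.rpow_add hL0]; congr 1; rw [hA'eq]; ring
      have e3 : (L ^ (-A')) ^ 4 = L ^ (-(4 * A')) := by
        rw [← Real.rpow_natCast (L ^ (-A')) 4, ← Real.rpow_mul hL0.le]; congr 1; push_cast; ring
      have e4 : L ^ (-(2 * A)) * L ^ (-(4 * A')) = L ^ (-σ) := by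
        rw [← Real.rpow_add hL0]; congr 1; rw [hσeq]; ring
      calc ((L ^ t)⁻¹ + L ^ (-A')) * (L ^ (-A')) ^ 4 * L ^ (2 ^ 20 : ℝ)
          = ((L ^ t)⁻¹ * L ^ (2 ^ 20 : ℝ) + L ^ (-A') * L ^ (2 ^ 20 : ℝ)) * (L ^ (-A')) ^ 4 := by ring
        _ = 2 * (L ^ (-(2 * A)) * L ^ (-(4 * A'))) := by rw [e1, e2, e3]; ring
        _ = 2 * L ^ (-σ) := by rw [e4]
    calc ((L ^ t)⁻¹ + L ^ (-A')) * (L ^ (-A')) ^ 4 * M ^ (1 / 2 : ℝ) * N ^ (3 / 2 : ℝ) * l ^ (2 ^ 20 : ℝ)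
        ≤ ((L ^ t)⁻¹ + L ^ (-A')) * (L ^ (-A')) ^ 4 * M ^ (1 / 2 : ℝ) * N ^ (3 / 2 : ℝ) *
            L ^ (2 ^ 20 : ℝ) := mul_le_mul_of_nonneg_left hl20 (by positivity)
      _ = (((L ^ t)⁻¹ + L ^ (-A')) * (L ^ (-A')) ^ 4 * L ^ (2 ^ 20 : ℝ)) *
            (M ^ (1 / 2 : ℝ) * N ^ (3 / 2 : ℝ)) := by ring
      _ = 2 * (L ^ (-σ) * (M ^ (1 / 2 : ℝ) * N ^ (3 / 2 : ℝ))) := by rw [hcoef]; ring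
  -- the main-term coefficient `c = 2 f̂(0) N'^{-1/2} ≤ 4 M^{1/2} N^{-1/2}`
  have hf0 := fiRadMean_nonneg M
  have hc0 : 0 ≤ 2 * fiRadMean M * N' ^ (-(1 / 2 : ℝ)) := by positivity
  have hc : 2 * fiRadMean M * N' ^ (-(1 / 2 : ℝ)) ≤ 4 * M ^ (1 / 2 : ℝ) * N ^ (-(1 / 2 : ℝ)) := by
    have h1 := fiRadMean_le hM0
    have h2 : N' ^ (-(1 / 2 : ℝ)) ≤ N ^ (-(1 / 2 : ℝ)) :=
      Real.rpow_le_rpow_of_nonpos hN0 hr.N'_gt.le (by norm_num)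
    have h3 : 0 ≤ N' ^ (-(1 / 2 : ℝ)) := by positivity
    calc 2 * fiRadMean M * N' ^ (-(1 / 2 : ℝ)) ≤ 2 * (2 * M ^ (1 / 2 : ℝ)) * N' ^ (-(1 / 2 : ℝ)) :=
          mul_le_mul_of_nonneg_right (mul_le_mul_of_nonneg_left h1 (by norm_num)) h3
      _ ≤ 2 * (2 * M ^ (1 / 2 : ℝ)) * N ^ (-(1 / 2 : ℝ)) := mul_le_mul_of_nonneg_left h2 (by positivity)
      _ = 4 * M ^ (1 / 2 : ℝ) * N ^ (-(1 / 2 : ℝ)) := by ring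
  -- (T3) c K₂ N² (log N)^{-σ} ≤ 4·4^σ K₂ W
  have hT3 : 2 * fiRadMean M * N' ^ (-(1 / 2 : ℝ)) * (K₂ * (N ^ 2 * l ^ (-σ)))
      ≤ 4 * 4 ^ σ * K₂ * (L ^ (-σ) * (M ^ (1 / 2 : ℝ) * N ^ (3 / 2 : ℝ))) := by
    have hlσ : l ^ (-σ) ≤ 4 ^ σ * L ^ (-σ) := by
      have hηL : 0 ≤ η * L := by positivity
      have h1 : l ^ (-σ) ≤ (L / 4) ^ (-σ) :=
        Real.rpow_le_rpow_of_nonpos (by positivity) (by linarith) (by linarith)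
      rw [Real.div_rpow hL0.le (by norm_num : (0 : ℝ) ≤ 4) (-σ),
        Real.rpow_neg (by norm_num : (0 : ℝ) ≤ 4) σ, div_inv_eq_mul] at h1
      calc l ^ (-σ) ≤ L ^ (-σ) * 4 ^ σ := h1
        _ = 4 ^ σ * L ^ (-σ) := mul_comm _ _
    calc 2 * fiRadMean M * N' ^ (-(1 / 2 : ℝ)) * (K₂ * (N ^ 2 * l ^ (-σ)))
        ≤ (4 * M ^ (1 / 2 : ℝ) * N ^ (-(1 / 2 : ℝ))) * (K₂ * (N ^ 2 * (4 ^ σ * L ^ (-σ)))) := by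
          refine mul_le_mul hc ?_ (by positivity) (by positivity)
          exact mul_le_mul_of_nonneg_left (mul_le_mul_of_nonneg_left hlσ (by positivity)) hK₂.le
      _ = 4 * 4 ^ σ * K₂ * (L ^ (-σ) * (M ^ (1 / 2 : ℝ) * (N ^ (-(1 / 2 : ℝ)) * N ^ 2))) := by ring
      _ = 4 * 4 ^ σ * K₂ * (L ^ (-σ) * (M ^ (1 / 2 : ℝ) * N ^ (3 / 2 : ℝ))) := by rw [hN2]
  -- (T4) c K₂ P⁻¹ N² log N ≤ 4 K₂ W
  have hT4 : 2 * fiRadMean M * N' ^ (-(1 / 2 : ℝ)) * (K₂ * (P⁻¹ * N ^ 2 * l))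
      ≤ 4 * K₂ * (L ^ (-σ) * (M ^ (1 / 2 : ℝ) * N ^ (3 / 2 : ℝ))) := by
    have hPl : P⁻¹ * l ≤ L ^ (-σ) := by
      have h1 : P⁻¹ ≤ (L ^ (σ + 1))⁻¹ := inv_anti₀ (by positivity) hPge
      calc P⁻¹ * l ≤ (L ^ (σ + 1))⁻¹ * L := mul_le_mul h1 hlN_le hlN0.le (by positivity)
        _ = L ^ (-σ) := by
            rw [← Real.rpow_neg hL0.le (σ + 1), ← Real.rpow_add_one hL0.ne']; congr 1; ring
    calc 2 * fiRadMean M * N' ^ (-(1 / 2 : ℝ)) * (K₂ * (P⁻¹ * N ^ 2 * l))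
        ≤ (4 * M ^ (1 / 2 : ℝ) * N ^ (-(1 / 2 : ℝ))) * (K₂ * (L ^ (-σ) * N ^ 2)) := by
          refine mul_le_mul hc ?_ (by positivity) (by positivity)
          refine mul_le_mul_of_nonneg_left ?_ hK₂.le
          calc P⁻¹ * N ^ 2 * l = (P⁻¹ * l) * N ^ 2 := by ring
            _ ≤ L ^ (-σ) * N ^ 2 := mul_le_mul_of_nonneg_right hPl (by positivity)
      _ = 4 * K₂ * (L ^ (-σ) * (M ^ (1 / 2 : ℝ) * (N ^ (-(1 / 2 : ℝ)) * N ^ 2))) := by ring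
      _ = 4 * K₂ * (L ^ (-σ) * (M ^ (1 / 2 : ℝ) * N ^ (3 / 2 : ℝ))) := by rw [hN2]
  -- assemble: 𝒟* ≤ |𝒟* − main| + main
  have hD : fiDispersionCoprime q p z₀ M N' (L ^ (-A')) C P (L ^ t)
      ≤ K₁ * ((L ^ (-A))⁻¹ * (L ^ t) ^ 2 * N ^ 2 * l ^ b
          + ((L ^ t)⁻¹ + L ^ (-A')) * (L ^ (-A')) ^ 4 * M ^ (1 / 2 : ℝ) * N ^ (3 / 2 : ℝ) *
              l ^ (2 ^ 20 : ℝ))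
        + (2 * fiRadMean M * N' ^ (-(1 / 2 : ℝ)) * (K₂ * (N ^ 2 * l ^ (-σ)))
          + 2 * fiRadMean M * N' ^ (-(1 / 2 : ℝ)) * (K₂ * (P⁻¹ * N ^ 2 * l))) := by
    have h1 := (abs_sub_le_iff.1 hmain).1
    have h2 : 2 * fiRadMean M * N' ^ (-(1 / 2 : ℝ)) *
          fiT (fiZSet z₀ N' (L ^ (-A'))) (fiZWeight₀ q p C P)
        ≤ 2 * fiRadMean M * N' ^ (-(1 / 2 : ℝ)) * (K₂ * (N ^ 2 * l ^ (-σ) + P⁻¹ * N ^ 2 * l)) :=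
      mul_le_mul_of_nonneg_left ((le_abs_self _).trans hTb) hc0
    have h3 : 2 * fiRadMean M * N' ^ (-(1 / 2 : ℝ)) * (K₂ * (N ^ 2 * l ^ (-σ) + P⁻¹ * N ^ 2 * l))
        = 2 * fiRadMean M * N' ^ (-(1 / 2 : ℝ)) * (K₂ * (N ^ 2 * l ^ (-σ)))
          + 2 * fiRadMean M * N' ^ (-(1 / 2 : ℝ)) * (K₂ * (P⁻¹ * N ^ 2 * l)) := by ring
    linarith
  have hK₁T := mul_le_mul_of_nonneg_left (add_le_add hT1 hT2) hK₁.le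
  calc fiDispersionCoprime q p z₀ M N' (L ^ (-A')) C P (L ^ t)
      ≤ (3 * K₁ + 4 * 4 ^ σ * K₂ + 4 * K₂) * (L ^ (-σ) * (M ^ (1 / 2 : ℝ) * N ^ (3 / 2 : ℝ))) := by
        linarith
    _ ≤ (3 * K₁ + 4 * 4 ^ σ * K₂ + 4 * K₂) * (L ^ (-σ) * (M ^ (1 / 2 : ℝ) * N ^ (3 / 2 : ℝ))) *
          Real.log (M * N) ^ 8 := le_mul_of_one_le_right (by positivity) hl8
    _ = (3 * K₁ + 4 * 4 ^ σ * K₂ + 4 * K₂) * (L ^ (-A)) ^ 2 * (L ^ (-A')) ^ 4 *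
          (M ^ (1 / 2 : ℝ) * N ^ (3 / 2 : ℝ)) * Real.log (M * N) ^ 8 := by
        rw [← hϑθ]; ring

/-- **Theorem 1 (parity.S17) from the four block bounds** — the lattice-point block (9.10)+(10.10),
Proposition 15.1, Proposition 16.3 and Proposition 17.3, each an explicit hypothesis in the
quantifier shape of (5.25) (kernel composition through §18 and the tree's
`setOf_prime_sq_add_pow_four_infinite_of_coprimeDispersionBound`).
[cite: FriedlanderIwaniecAnnals1998, Theorem 1, §18] -/
theorem setOf_prime_sq_add_pow_four_infinite_of_blocks
    (hM : ∀ η : ℝ, 0 < η → ∃ b : ℝ, 0 ≤ b ∧ ∀ A A₁ A' t B : ℝ, 0 < A → 0 < A₁ → 0 < A' → 0 < t →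
      0 < B → ∃ K : ℝ, 0 < K ∧ MainTerm1010With η A A₁ A' t B b K)
    (hV : ∀ η A A₁ A' B : ℝ, 0 < η → 0 < A → 0 < A₁ → 2 ^ 20 ≤ A' → 0 < B →
      ∃ K : ℝ, 0 < K ∧ Prop151With η A A₁ A' B K)
    (hU : ∀ η A A₁ A' B : ℝ, 0 < η → 0 < A → 0 < A₁ → 2 ^ 20 ≤ A' → 0 < B →
      ∀ ν : ℝ, 0 < ν → ∃ K : ℝ, 0 < K ∧ Prop163With η A A₁ A' B ν K)
    (hW : ∀ η A A₁ A' B : ℝ, 0 < η → 0 < A → 0 < A₁ → 2 ^ 20 ≤ A' → 0 < B →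
      ∃ ε : ℝ, 0 < ε ∧ ∃ K : ℝ, 0 < K ∧ Prop173With η A A₁ A' B ε K) :
    setOf_prime_sq_add_pow_four_infinite :=
  setOf_prime_sq_add_pow_four_infinite_of_coprimeDispersionBound
    (coprimeDispersionBound_of_mainTerm hM (prop102_of_blocks hV hU hW))

end Literature.NumberTheory.Sieve.FriedlanderIwaniecPrimes
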